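import Summits.ResolutionOfSingularities.ResolutionOfSingularities.Theorems.MarkedTransferCampaignW46HonestPersistence
import HarnessLib

/-!
# [OURS · L1 W4.6 rung (i-g)] THE HONEST PROCEDURE RESOLVES: existence of embedded resolutions of ideal exponents on
# surfaces whose singular curves are regular (cell res-hironaka, LADDER-RESOLUTION rung L, D-0089; campaign s46, prover
# res-L1-s46-pv-1; host route MarkedTransfer, `--supports stmt-ResolutionOfSingularities-16155`)

HONEST FRAMING. Nothing here is a statement of H. Hironaka's manuscript (2017-03-23, [Hironaka2017]) and nothing here
asserts that any statement of it holds. OURS objects throughout; résumé-free (no notion instance, no `Inv`). AI-written;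
weaker than expert review. No `sorry`; axioms standard.

## The theorem

Over a perfect field `K : Type` of characteristic `p`, let `E₀ = (J, b)` be a standard ideal exponent on an ambient datum
`A₀` of dimension `≤ 2` whose singular curves are regular (`Regime.singCurvesRegular`, p535455; e.g. `Sing(E₀)` a finite
set of closed points). Then SOME finite sequence of HONEST steps — §2.1-permissible blow-ups whose centres do not
procrastinate (a regular singular curve, or a singular point through which no singular curve passes) — reaches a state
with EMPTY singular locus (`exists_honestReaches_resolved`). Proof: the honest step exists while `Sing ≠ ∅`
(`exists_honestStep`, p533497), the class is stable (`singCurvesRegular_transform`, p535455), and an infinite honest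
sequence on surfaces is impossible (rung (i-b), `planeNonProcrastinatingTerminates_holds`, p526033) — dependent choice.
Replaces the role of the resolution clause of Th. 16.13 p.87 l.26–28 («`E` is resolved … after finitely many
permissible blowups») for this class of surface states, by OUR procedure; says nothing about the manuscript's.

## Contents

* `HonestReaches A₀ E₀ A E` — `(A, E)` is reached from `(A₀, E₀)` by finitely many honest steps (inductive, `refl`/`step`).
* `GState`, `GState.seq`, `honestRun` — bookkeeping of the dependent-choice argument.
* **`exists_honestReaches_resolved`** — RUNG (i-g); `exists_honestReaches_resolved_of_forall_isClosed` — the case of a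
  singular locus consisting of closed points.

## References

* O. Zariski, P. Samuel, Commutative Algebra II (1960), Appendix 5; Q. Liu, Algebraic Geometry and Arithmetic Curves
  (2002), Thm. 8.1.19. [ZariskiSamuel1960] [Liu2002]
* H. Hironaka, ms. 2017-03-23, Th. 16.13 p.87 l.26–28 — the ROLE replaced only, not cited as fact. [Hironaka2017]
-/

noncomputable section

set_option linter.dupNamespace false -- mandated namespace of this single-conjunct summit

open CategoryTheory AlgebraicGeometry TopologicalSpace

namespace Summit.ResolutionOfSingularities.ResolutionOfSingularities.Theorems

namespace CampaignW46

open Literature.AlgebraicGeometry.Resolution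
open Literature.AlgebraicGeometry.Hironaka2017.S02Preliminaries
open Literature.AlgebraicGeometry.Hironaka2017.Datum
open Scheme.IdealSheafData

universe u

variable {p : ℕ} [Fact p.Prime] {K : Type u} [Field K] [CharP K p]

/-! ## Reachability by honest steps -/

/-- [OURS · L1 W4.6 rung (i-g)] NOT a statement of the manuscript. **`(A, E)` is reached from `(A₀, E₀)` by finitely many
HONEST steps**: the reflexive-transitive closure of «`E′` is the transform (Def. 2.1) of `E` along the blowing up
`π : Z′ → Z` (ambient datum over the same field) of a §2.1-permissible centre that does not procrastinate». [folklore] -/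
inductive HonestReaches (A₀ : AmbientDatum p K) (E₀ : IdealExponent A₀.Z) :
    ∀ A : AmbientDatum p K, IdealExponent A.Z → Prop
  | refl : HonestReaches A₀ E₀ A₀ E₀
  | step {A : AmbientDatum p K} {E : IdealExponent A.Z} {A' : AmbientDatum p K} (D : Closeds A.Z) (π : A'.Z ⟶ A.Z)
      (h : HonestReaches A₀ E₀ A E) (hD : E.IsPermissibleCentre A.hom D) (hnp : ¬ CentreProcrastinates E D)
      (hhom : A'.hom = π ≫ A.hom) (hπ : IsBlowup π (vanishingIdeal D)) :
      HonestReaches A₀ E₀ A' (E.transform π D)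

/-! ## Dependent choice: an infinite honest sequence if no reachable state is resolved -/

section Choice

variable [PerfectField K] {A₀ : AmbientDatum p K} {E₀ : IdealExponent A₀.Z}

/-- [OURS · L1 W4.6 rung (i-g)] Bookkeeping: a reachable surface state in the class, with its invariants. [folklore] -/
structure GState (A₀ : AmbientDatum p K) (E₀ : IdealExponent A₀.Z) where
  /-- ambient datum -/
  A : AmbientDatum p K
  /-- ideal exponent -/
  E : IdealExponent A.Z
  /-- reached by honest steps -/
  reach : HonestReaches A₀ E₀ A E
  /-- standard -/
  std : E.IsStandard
  /-- a surface (or curve) -/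
  dim : Regime.dimLE 2 A E
  /-- singular curves regular -/
  curves : Regime.singCurvesRegular A E

/-- [OURS · L1 W4.6 rung (i-g)] Bookkeeping: an honest step out of a state, with its target state. [folklore] -/
structure GState.Link (S : GState A₀ E₀) where
  /-- the next state -/
  S' : GState A₀ E₀
  /-- the centre -/
  D : Closeds S.A.Z
  /-- the blow-up -/
  π : S'.A.Z ⟶ S.A.Z
  /-- permissible -/
  perm : S.E.IsPermissibleCentre S.A.hom D
  /-- honest -/
  honest : ¬ CentreProcrastinates S.E D
  /-- same base field -/
  hom_eq : S'.A.hom = π ≫ S.A.hom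
  /-- blow-up along the centre -/
  blowup : IsBlowup π (vanishingIdeal D)
  /-- the next ideal exponent is the transform -/
  hE : S'.E = S.E.transform π D

/-- If no reachable state is resolved, every state has an honest successor in the class (`exists_honestStep` +
`singCurvesRegular_transform`). [folklore] -/
theorem GState.nonempty_link (hstuck : ∀ (A : AmbientDatum p K) (E : IdealExponent A.Z), HonestReaches A₀ E₀ A E →
      E.sing.Nonempty) (S : GState A₀ E₀) : Nonempty S.Link := by
  obtain ⟨A', D, π, hD, hnp, hhom, hπ, hst, hdim⟩ :=
    exists_honestStep S.A S.E S.std (hstuck _ _ S.reach) S.curves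
  have hP' := singCurvesRegular_transform S.A A' S.E S.std S.dim S.curves hD hnp hπ
  exact ⟨⟨⟨A', _, S.reach.step D π hD hnp hhom hπ, hst, hdim 2 S.dim, hP'⟩, D, π, hD, hnp, hhom, hπ, rfl⟩⟩

/-- A chosen successor. [folklore] -/
def GState.next (hstuck : ∀ (A : AmbientDatum p K) (E : IdealExponent A.Z), HonestReaches A₀ E₀ A E →
      E.sing.Nonempty) (S : GState A₀ E₀) : S.Link :=
  Classical.choice (S.nonempty_link hstuck)

/-- The sequence of states. [folklore] -/
def GState.seq (hstuck : ∀ (A : AmbientDatum p K) (E : IdealExponent A.Z), HonestReaches A₀ E₀ A E →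
      E.sing.Nonempty) (S₀ : GState A₀ E₀) : ℕ → GState A₀ E₀
  | 0 => S₀
  | k + 1 => ((GState.seq hstuck S₀ k).next hstuck).S'

/-- [OURS · L1 W4.6 rung (i-g)] The infinite honest §2.1-permissible sequence that would exist if no reachable state were
resolved. [folklore] -/
def honestRun (hstuck : ∀ (A : AmbientDatum p K) (E : IdealExponent A.Z), HonestReaches A₀ E₀ A E →
      E.sing.Nonempty) (S₀ : GState A₀ E₀) : PermissibleRun p K where
  A k := (S₀.seq hstuck k).A
  E k := (S₀.seq hstuck k).E
  D k := ((S₀.seq hstuck k).next hstuck).D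
  π k := ((S₀.seq hstuck k).next hstuck).π
  standard k := (S₀.seq hstuck k).std
  permissible k := ((S₀.seq hstuck k).next hstuck).perm
  hom_eq k := ((S₀.seq hstuck k).next hstuck).hom_eq
  blowup k := ((S₀.seq hstuck k).next hstuck).blowup
  E_succ k := ((S₀.seq hstuck k).next hstuck).hE

/-- Its stages are surfaces (or curves). [folklore] -/
theorem honestRun_dimLE (hstuck : ∀ (A : AmbientDatum p K) (E : IdealExponent A.Z), HonestReaches A₀ E₀ A E →
      E.sing.Nonempty) (S₀ : GState A₀ E₀) (k : ℕ) :
    Regime.dimLE 2 ((honestRun hstuck S₀).A k) ((honestRun hstuck S₀).E k) :=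
  (S₀.seq hstuck k).dim

/-- None of its steps procrastinates. [folklore] -/
theorem honestRun_not_procrastinates (hstuck : ∀ (A : AmbientDatum p K) (E : IdealExponent A.Z),
      HonestReaches A₀ E₀ A E → E.sing.Nonempty) (S₀ : GState A₀ E₀) (k : ℕ) :
    ¬ (honestRun hstuck S₀).Procrastinates k :=
  ((S₀.seq hstuck k).next hstuck).honest

end Choice

/-! ## Rung (i-g): the honest procedure resolves -/

/-- [OURS · L1 W4.6 rung (i-g)] NOT a statement of the manuscript. **EXISTENCE OF RESOLUTION BY THE HONEST PROCEDURE ON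
SURFACES.** Over a perfect field `K : Type` of characteristic `p`: for a standard ideal exponent `E₀` on an ambient datum
`A₀` of dimension `≤ 2` whose singular curves are regular (`Regime.singCurvesRegular A₀ E₀`), some state `(A, E)` reached
from `(A₀, E₀)` by finitely many honest steps (§2.1-permissible blow-ups with non-procrastinating centres, transforms of
Def. 2.1) has `Sing(E) = ∅` — `E` is resolved. Replaces the role of the resolution clause of Th. 16.13 p.87 l.26–28 for
this class, by OUR procedure. [folklore] -/
theorem exists_honestReaches_resolved {K : Type} [Field K] [CharP K p] [PerfectField K] (A₀ : AmbientDatum p K)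
    (E₀ : IdealExponent A₀.Z) (hE₀ : E₀.IsStandard) (hdim₀ : Regime.dimLE 2 A₀ E₀)
    (hP₀ : Regime.singCurvesRegular A₀ E₀) :
    ∃ (A : AmbientDatum p K) (E : IdealExponent A.Z), HonestReaches A₀ E₀ A E ∧ E.sing = ∅ := by
  by_contra h
  have hstuck : ∀ (A : AmbientDatum p K) (E : IdealExponent A.Z), HonestReaches A₀ E₀ A E → E.sing.Nonempty :=
    fun A E hr => Set.nonempty_iff_ne_empty.mpr fun he => h ⟨A, E, hr, he⟩
  let S₀ : GState A₀ E₀ := ⟨A₀, E₀, HonestReaches.refl, hE₀, hdim₀, hP₀⟩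
  exact planeNonProcrastinatingTerminates_holds p K (honestRun hstuck S₀) (honestRun_dimLE hstuck S₀)
    (honestRun_not_procrastinates hstuck S₀)

/-- [OURS · L1 W4.6 rung (i-g)] NOT a statement of the manuscript. **The case of a singular locus of closed points** (e.g.
finite `Sing(E₀)` of closed points, the regime of rung (i-a)): the honest procedure — here: blow up singular points through
which no singular curve passes, or regular singular curves when they appear — resolves `E₀` on a surface over a perfect
field. [folklore] -/
theorem exists_honestReaches_resolved_of_forall_isClosed {K : Type} [Field K] [CharP K p] [PerfectField K]
    (A₀ : AmbientDatum p K) (E₀ : IdealExponent A₀.Z) (hE₀ : E₀.IsStandard) (hdim₀ : Regime.dimLE 2 A₀ E₀)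
    (hcl : ∀ η ∈ E₀.sing, IsClosed ({η} : Set A₀.Z)) :
    ∃ (A : AmbientDatum p K) (E : IdealExponent A.Z), HonestReaches A₀ E₀ A E ∧ E.sing = ∅ :=
  exists_honestReaches_resolved A₀ E₀ hE₀ hdim₀ fun η hη hncl => absurd (hcl η hη) hncl

end CampaignW46

end Summit.ResolutionOfSingularities.ResolutionOfSingularities.Theorems

end
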